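import Mathlib
import Literature.AlgebraicGeometry.HyperbolicPolynomials.SpectrahedralShadowCalculus
import HarnessLib

/-!
# The Putinar-type moment relaxation of a set `{p ≥ 0, q ≥ 0}` and its exactness criterion

Topic `Literature/AlgebraicGeometry/HyperbolicPolynomials`. The lifted LMI of Lasserre / Parrilo /
Helton–Nie for a basic closed semialgebraic set with two defining polynomials, in the truncated
form used in `LocalExactness.lean`: for `N = {x | p(x) ≥ 0 ∧ q(x) ≥ 0} ⊆ ℝᵏ` and an order `D`,

  `R_D = {x | ∃ y (moments of order ≤ 2D+2): y₀ = 1, y_{eᵢ} = xᵢ, M_D(y) ⪰ 0, M_D(q·y) ⪰ 0,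
          L_y(p) ≥ 0}`

(moment matrix, localizing matrix of `q`, and the single scalar condition `L_y(p) ≥ 0`, `L_y`
the Riesz functional). We index truncated moments by the *box* `(Fin k → Fin (T+1))` of
exponents with entries `≤ T` rather than by total degree (a harmless enlargement that keeps all
index types `Fintype` for free).

## Main results (namespace `Literature.AlgebraicGeometry.HyperbolicPolynomials`)

* `momentRelaxation D p q` and `isSpectrahedralShadow_momentRelaxation` — `R_D` is a
  spectrahedral shadow (Helton–Nie 2010, §2.2, construction (2.?) "SDP representation II").
* `subset_momentRelaxation` — `N ⊆ R_D` (moments of Dirac measures), when `degᵢ p ≤ 2D+2`,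
  `degᵢ q ≤ 2`.
* `exists_functional_of_mem_momentRelaxation` — a point of `R_D` carries a linear functional `L`
  on `ℝ[X]` with `L(1) = 1`, `L(Xᵢ) = xᵢ`, `L(h²) ≥ 0` and `L(q h²) ≥ 0` for `deg h ≤ D`, and
  `L(p) ≥ 0`.
* `momentRelaxation_subset_of_certificates` — **exactness criterion** (Helton–Nie 2010, §2.2 /
  Lasserre 2009, Thm 2, "PP-BDNR ⇒ the lifted LMI is exact", in the form needed here): if `N` is
  compact, convex and non-empty and every affine function `ℓ(x) = c(x - w)` supporting `N` at a
  minimiser `w` of `c` satisfies `L(ℓ - λp) ≥ 0` for some `λ ≥ 0` and *every* functional `L`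
  positive on squares of degree `≤ D` and on `q`-multiples of such squares, then `R_D ⊆ N`;
  with the previous item, `N = R_D` is a spectrahedral shadow
  (`isSpectrahedralShadow_of_certificates`). The proof is the separation argument of Helton–Nie,
  §2.1: a point `x ∈ R_D ∖ N` is strictly separated from `N` by some `c`
  (`geometric_hahn_banach_point_closed`), and applying `L_y` to the certificate of
  `ℓ = c(· - w)` gives `0 ≤ L_y(ℓ) = c(x) - c(w) < 0`.

## References

* [HeltonNie2008] J. W. Helton, J. Nie, *Semidefinite representation of convex sets*,
  Math. Program. 122 (2010) 21–64 (arXiv:0705.4068): §2.1 (moment and localizing matrices,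
  separating functionals), §2.2 (SDP representation II, PP-BDR/PP-BDNR).
* J. B. Lasserre, *Convex sets with semidefinite representation*, Math. Program. 120 (2009)
  457–477, Thm 2, as quoted in [HeltonNie2008, §2.2].
-/

noncomputable section

open MvPolynomial
open scoped BigOperators Matrix

namespace Literature.AlgebraicGeometry.HyperbolicPolynomials

variable {k : ℕ}

/-! ### Box-indexed exponents and truncated moment vectors -/

/-- Exponent vectors with all entries `≤ T`, as functions `Fin k → Fin (T+1)` (a `Fintype`).
[cite: HeltonNie2008, §2.1 (truncated moment vectors)] -/
abbrev BoxIdx (k T : ℕ) := Fin k → Fin (T + 1)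

namespace BoxIdx

variable {T : ℕ}

/-- The exponent vector of a box index. [folklore] -/
def toExp (β : BoxIdx k T) : Fin k →₀ ℕ := Finsupp.equivFunOnFinite.symm fun i => (β i : ℕ)

/-- [folklore] -/
@[simp] theorem toExp_apply (β : BoxIdx k T) (i : Fin k) : β.toExp i = β i := by
  simp [toExp]

/-- The box index of an exponent with entries `≤ T`. [folklore] -/
def ofExp (T : ℕ) (α : Fin k →₀ ℕ) (h : ∀ i, α i ≤ T) : BoxIdx k T :=
  fun i => ⟨α i, Nat.lt_succ_of_le (h i)⟩

/-- [folklore] -/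
@[simp] theorem toExp_ofExp (α : Fin k →₀ ℕ) (h : ∀ i, α i ≤ T) : (ofExp T α h).toExp = α := by
  ext i; simp [ofExp]

/-- [folklore] -/
theorem le_of_idx (β : BoxIdx k T) (i : Fin k) : β.toExp i ≤ T := by
  rw [toExp_apply]; exact Nat.le_of_lt_succ (β i).2

/-- [folklore] -/
@[simp] theorem ofExp_toExp (β : BoxIdx k T) : ofExp T β.toExp (le_of_idx β) = β := by
  funext i; apply Fin.ext; simp [ofExp]

/-- [folklore] -/
theorem toExp_injective : Function.Injective (toExp : BoxIdx k T → Fin k →₀ ℕ) := by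
  intro β γ h
  funext i; apply Fin.ext
  have := congrArg (fun α : Fin k →₀ ℕ => α i) h
  simpa using this

end BoxIdx

/-- The truncated moment `y_α` of a box-indexed vector `y` (zero outside the box).
[cite: HeltonNie2008, §2.1 (truncated moment vectors)] -/
def boxMoment (T : ℕ) (y : BoxIdx k T → ℝ) (α : Fin k →₀ ℕ) : ℝ :=
  if h : ∀ i, α i ≤ T then y (BoxIdx.ofExp T α h) else 0

/-- [folklore] -/
theorem boxMoment_of_le {T : ℕ} (y : BoxIdx k T → ℝ) {α : Fin k →₀ ℕ} (h : ∀ i, α i ≤ T) :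
    boxMoment T y α = y (BoxIdx.ofExp T α h) := by
  rw [boxMoment, dif_pos h]

/-- [folklore] -/
@[simp] theorem boxMoment_toExp {T : ℕ} (y : BoxIdx k T → ℝ) (β : BoxIdx k T) :
    boxMoment T y β.toExp = y β := by
  rw [boxMoment_of_le y (BoxIdx.le_of_idx β), BoxIdx.ofExp_toExp]

/-- [folklore] -/
theorem boxMoment_add {T : ℕ} (y y' : BoxIdx k T → ℝ) (α : Fin k →₀ ℕ) :
    boxMoment T (y + y') α = boxMoment T y α + boxMoment T y' α := by
  unfold boxMoment; split_ifs <;> simp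

/-- [folklore] -/
theorem boxMoment_smul {T : ℕ} (c : ℝ) (y : BoxIdx k T → ℝ) (α : Fin k →₀ ℕ) :
    boxMoment T (c • y) α = c * boxMoment T y α := by
  unfold boxMoment; split_ifs <;> simp

/-- `y ↦ y_α` as a linear map. [folklore] -/
def boxMomentLin (T : ℕ) (α : Fin k →₀ ℕ) : (BoxIdx k T → ℝ) →ₗ[ℝ] ℝ where
  toFun y := boxMoment T y α
  map_add' y y' := boxMoment_add y y' α
  map_smul' c y := boxMoment_smul c y α

/-- [folklore] -/
@[simp] theorem boxMomentLin_apply (T : ℕ) (α : Fin k →₀ ℕ) (y : BoxIdx k T → ℝ) :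
    boxMomentLin T α y = boxMoment T y α := rfl

/-! ### The Riesz functional of a truncated moment vector -/

/-- The **Riesz functional** `L_y` on all of `ℝ[X₁,…,X_k]`: `L_y(X^α) = y_α` (and `0` beyond the
box). [cite: HeltonNie2008, §2.1 (moments and linear functionals)] -/
def rieszFun (T : ℕ) (y : BoxIdx k T → ℝ) : MvPolynomial (Fin k) ℝ →ₗ[ℝ] ℝ :=
  (MvPolynomial.basisMonomials (Fin k) ℝ).constr ℝ (boxMoment T y)

/-- [folklore] -/
theorem rieszFun_monomial {T : ℕ} (y : BoxIdx k T → ℝ) (α : Fin k →₀ ℕ) (c : ℝ) :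
    rieszFun T y (monomial α c) = c * boxMoment T y α := by
  have h1 : (monomial α c : MvPolynomial (Fin k) ℝ) = c • (MvPolynomial.basisMonomials (Fin k) ℝ) α := by
    rw [MvPolynomial.coe_basisMonomials, smul_monomial, smul_eq_mul, mul_one]
  rw [h1, map_smul, rieszFun, Module.Basis.constr_basis, smul_eq_mul]

/-- `L_y(f) = Σ_α coeff_α(f) y_α`. [folklore] -/
theorem rieszFun_apply {T : ℕ} (y : BoxIdx k T → ℝ) (f : MvPolynomial (Fin k) ℝ) :
    rieszFun T y f = ∑ α ∈ f.support, coeff α f * boxMoment T y α := by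
  conv_lhs => rw [f.as_sum, map_sum]
  exact Finset.sum_congr rfl fun α _ => rieszFun_monomial y α _

/-- [folklore] -/
theorem rieszFun_one {T : ℕ} (y : BoxIdx k T → ℝ) : rieszFun T y 1 = boxMoment T y 0 := by
  rw [show (1 : MvPolynomial (Fin k) ℝ) = monomial 0 1 from rfl, rieszFun_monomial, one_mul]

/-- [folklore] -/
theorem rieszFun_X {T : ℕ} (y : BoxIdx k T → ℝ) (i : Fin k) :
    rieszFun T y (X i) = boxMoment T y (Finsupp.single i 1) := by
  rw [show (X i : MvPolynomial (Fin k) ℝ) = monomial (Finsupp.single i 1) 1 from rfl,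
    rieszFun_monomial, one_mul]

/-- `y ↦ L_y(f)` as a linear map. [folklore] -/
def rieszLin (T : ℕ) (f : MvPolynomial (Fin k) ℝ) : (BoxIdx k T → ℝ) →ₗ[ℝ] ℝ where
  toFun y := rieszFun T y f
  map_add' y y' := by
    simp only [rieszFun_apply, boxMoment_add, mul_add, Finset.sum_add_distrib]
  map_smul' c y := by
    simp only [rieszFun_apply, boxMoment_smul, RingHom.id_apply, smul_eq_mul, Finset.mul_sum]
    exact Finset.sum_congr rfl fun α _ => by ring

/-- [folklore] -/
@[simp] theorem rieszLin_apply (T : ℕ) (f : MvPolynomial (Fin k) ℝ) (y : BoxIdx k T → ℝ) :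
    rieszLin T f y = rieszFun T y f := rfl

/-! ### Point (Dirac) moments -/

/-- The moments `x^α` of the Dirac measure at `x`. [cite: HeltonNie2008, §2.1 (`y_α = x^α`)] -/
def pointMoments (T : ℕ) (x : Fin k → ℝ) : BoxIdx k T → ℝ := fun β => ∏ i, x i ^ (β i : ℕ)

/-- [folklore] -/
theorem boxMoment_pointMoments {T : ℕ} (x : Fin k → ℝ) {α : Fin k →₀ ℕ} (h : ∀ i, α i ≤ T) :
    boxMoment T (pointMoments T x) α = ∏ i, x i ^ α i := by
  rw [boxMoment_of_le _ h, pointMoments]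
  exact Finset.prod_congr rfl fun i _ => by simp [BoxIdx.ofExp]

/-- An exponent in the support is bounded coordinatewise by `degreeOf`. [folklore] -/
theorem apply_le_degreeOf {f : MvPolynomial (Fin k) ℝ} {α : Fin k →₀ ℕ} (hα : α ∈ f.support)
    (i : Fin k) : α i ≤ degreeOf i f :=
  MvPolynomial.monomial_le_degreeOf i hα

/-- On polynomials whose exponents stay in the box, the Riesz functional of the Dirac moments is
evaluation. [cite: HeltonNie2008, §2.1 (`S ⊆ ρ_N(Ŝ_N)`)] -/
theorem rieszFun_pointMoments {T : ℕ} (x : Fin k → ℝ) {f : MvPolynomial (Fin k) ℝ}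
    (hf : ∀ i, degreeOf i f ≤ T) : rieszFun T (pointMoments T x) f = MvPolynomial.eval x f := by
  rw [rieszFun_apply, MvPolynomial.eval_eq']
  refine Finset.sum_congr rfl fun α hα => ?_
  rw [boxMoment_pointMoments x fun i => (apply_le_degreeOf hα i).trans (hf i)]

/-! ### Box polynomials, the moment matrix and the localizing matrix -/

/-- The polynomial with box-indexed coefficient vector `c`: `Σ_β c_β X^β`. [folklore] -/
def boxPoly (D : ℕ) (c : BoxIdx k D → ℝ) : MvPolynomial (Fin k) ℝ := ∑ β, monomial β.toExp (c β)

/-- Every polynomial of total degree `≤ D` is a box polynomial. [folklore] -/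
theorem exists_boxPoly_eq {D : ℕ} (h : MvPolynomial (Fin k) ℝ) (hh : h.totalDegree ≤ D) :
    ∃ c : BoxIdx k D → ℝ, boxPoly D c = h := by
  classical
  have hbox : ∀ α ∈ h.support, ∀ i, α i ≤ D := fun α hα i =>
    ((apply_le_degreeOf hα i).trans (degreeOf_le_totalDegree h i)).trans hh
  refine ⟨fun β => coeff β.toExp h, ?_⟩
  ext α
  rw [boxPoly, coeff_sum]
  simp only [coeff_monomial]
  by_cases hα : ∀ i, α i ≤ D
  · rw [Finset.sum_eq_single (BoxIdx.ofExp D α hα)]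
    · simp
    · intro β _ hβ
      rw [if_neg]
      intro h'
      subst h'
      exact hβ (BoxIdx.ofExp_toExp β).symm
    · intro hh'; exact absurd (Finset.mem_univ _) hh'
  · rw [Finset.sum_eq_zero]
    · by_contra hne
      exact hα (hbox α (mem_support_iff.2 (Ne.symm hne)))
    · intro β _
      rw [if_neg]
      intro h'
      exact hα (h' ▸ BoxIdx.le_of_idx β)

/-- Exponents of a box polynomial stay in the box. [folklore] -/
theorem degreeOf_boxPoly_le {D : ℕ} (c : BoxIdx k D → ℝ) (i : Fin k) : degreeOf i (boxPoly D c) ≤ D := by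
  classical
  rw [degreeOf_le_iff]
  intro α hα
  obtain ⟨β, -, hβ⟩ := Finset.mem_biUnion.1 (support_sum hα)
  have : α = β.toExp := by
    have := support_monomial_subset hβ
    rwa [Finset.mem_singleton] at this
  rw [this]; exact BoxIdx.le_of_idx β i

/-- The **moment matrix** `M_D(y)_{βγ} = y_{β+γ}`. [cite: HeltonNie2008, §2.1 (moment matrix)] -/
def momentMatrix (D T : ℕ) (y : BoxIdx k T → ℝ) : Matrix (BoxIdx k D) (BoxIdx k D) ℝ :=
  Matrix.of fun β γ => boxMoment T y (β.toExp + γ.toExp)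

/-- The **localizing matrix** `M_D(q·y)_{βγ} = Σ_α q_α y_{α+β+γ}`.
[cite: HeltonNie2008, §2.1 (localizing matrix)] -/
def locMatrix (D T : ℕ) (q : MvPolynomial (Fin k) ℝ) (y : BoxIdx k T → ℝ) :
    Matrix (BoxIdx k D) (BoxIdx k D) ℝ :=
  Matrix.of fun β γ => ∑ α ∈ q.support, coeff α q * boxMoment T y (α + β.toExp + γ.toExp)

/-- The moment matrix depends linearly on `y`. [folklore] -/
def momentMatrixLin (D T : ℕ) : (BoxIdx k T → ℝ) →ₗ[ℝ] Matrix (BoxIdx k D) (BoxIdx k D) ℝ where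
  toFun y := momentMatrix D T y
  map_add' y y' := by ext β γ; simp [momentMatrix, boxMoment_add]
  map_smul' c y := by ext β γ; simp [momentMatrix, boxMoment_smul]

/-- The localizing matrix depends linearly on `y`. [folklore] -/
def locMatrixLin (D T : ℕ) (q : MvPolynomial (Fin k) ℝ) :
    (BoxIdx k T → ℝ) →ₗ[ℝ] Matrix (BoxIdx k D) (BoxIdx k D) ℝ where
  toFun y := locMatrix D T q y
  map_add' y y' := by
    ext β γ; simp [locMatrix, boxMoment_add, mul_add, Finset.sum_add_distrib]
  map_smul' c y := by
    ext β γ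
    simp only [locMatrix, boxMoment_smul, Matrix.of_apply, Matrix.smul_apply, smul_eq_mul,
      RingHom.id_apply, Finset.mul_sum]
    exact Finset.sum_congr rfl fun α _ => by ring

/-- [folklore] -/
@[simp] theorem momentMatrixLin_apply (D T : ℕ) (y : BoxIdx k T → ℝ) :
    momentMatrixLin D T y = momentMatrix D T y := rfl

/-- [folklore] -/
@[simp] theorem locMatrixLin_apply (D T : ℕ) (q : MvPolynomial (Fin k) ℝ) (y : BoxIdx k T → ℝ) :
    locMatrixLin D T q y = locMatrix D T q y := rfl

/-- `(Σ c_β X^β)² = Σ_{βγ} c_β c_γ X^{β+γ}`. [folklore] -/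
theorem boxPoly_sq {D : ℕ} (c : BoxIdx k D → ℝ) :
    boxPoly D c ^ 2 = ∑ β, ∑ γ, monomial (β.toExp + γ.toExp) (c β * c γ) := by
  rw [sq, boxPoly, Finset.sum_mul_sum]
  exact Finset.sum_congr rfl fun β _ => Finset.sum_congr rfl fun γ _ => monomial_mul

/-- **The moment matrix is the Gram matrix of `L_y` on squares**: `L_y((Σ c_β X^β)²) = cᵀ M_D(y) c`.
[cite: HeltonNie2008, §2.1 (moment matrix)] -/
theorem rieszFun_boxPoly_sq {D T : ℕ} (y : BoxIdx k T → ℝ) (c : BoxIdx k D → ℝ) :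
    rieszFun T y (boxPoly D c ^ 2) = c ⬝ᵥ (momentMatrix D T y *ᵥ c) := by
  rw [boxPoly_sq, map_sum]
  simp only [map_sum, rieszFun_monomial, dotProduct, Matrix.mulVec, momentMatrix, Matrix.of_apply,
    Finset.mul_sum]
  exact Finset.sum_congr rfl fun β _ => Finset.sum_congr rfl fun γ _ => by ring

/-- **The localizing matrix is the Gram matrix of `L_y(q ·)` on squares**:
`L_y(q (Σ c_β X^β)²) = cᵀ M_D(q·y) c`. [cite: HeltonNie2008, §2.1 (localizing matrix)] -/
theorem rieszFun_mul_boxPoly_sq {D T : ℕ} (y : BoxIdx k T → ℝ) (q : MvPolynomial (Fin k) ℝ)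
    (c : BoxIdx k D → ℝ) :
    rieszFun T y (q * boxPoly D c ^ 2) = c ⬝ᵥ (locMatrix D T q y *ᵥ c) := by
  have hq : q * boxPoly D c ^ 2 =
      ∑ β, ∑ γ, ∑ α ∈ q.support, monomial (α + β.toExp + γ.toExp) (coeff α q * (c β * c γ)) := by
    rw [boxPoly_sq, Finset.mul_sum]
    refine Finset.sum_congr rfl fun β _ => ?_
    rw [Finset.mul_sum]
    refine Finset.sum_congr rfl fun γ _ => ?_
    conv_lhs => rw [q.as_sum, Finset.sum_mul]
    exact Finset.sum_congr rfl fun α _ => by rw [monomial_mul, add_assoc]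
  rw [hq]
  simp only [map_sum, rieszFun_monomial, dotProduct, Matrix.mulVec, locMatrix, Matrix.of_apply,
    Finset.mul_sum, Finset.sum_mul]
  exact Finset.sum_congr rfl fun β _ => Finset.sum_congr rfl fun γ _ =>
    Finset.sum_congr rfl fun α _ => by ring

/-- The moment matrix is symmetric. [folklore] -/
theorem momentMatrix_isHermitian {D T : ℕ} (y : BoxIdx k T → ℝ) : (momentMatrix D T y).IsHermitian :=
  Matrix.IsHermitian.ext fun β γ => by simp [momentMatrix, add_comm]

/-- The localizing matrix is symmetric. [folklore] -/
theorem locMatrix_isHermitian {D T : ℕ} (q : MvPolynomial (Fin k) ℝ) (y : BoxIdx k T → ℝ) :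
    (locMatrix D T q y).IsHermitian :=
  Matrix.IsHermitian.ext fun β γ => by
    simp only [locMatrix, Matrix.of_apply, star_trivial]
    exact Finset.sum_congr rfl fun α _ => by rw [add_assoc, add_comm γ.toExp, ← add_assoc]

/-! ### The relaxation and its lifted LMI -/

/-- **The order-`D` Putinar-type moment relaxation** of `{p ≥ 0, q ≥ 0}` (moments of box order
`2D+2`; moment matrix and `q`-localizing matrix of order `D`; the scalar condition `L_y(p) ≥ 0`;
normalisation `y₀ = 1`; and `x = (y_{eᵢ})ᵢ`).
[cite: HeltonNie2008, §2.2 (SDP representation II)] -/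
def momentRelaxation (D : ℕ) (p q : MvPolynomial (Fin k) ℝ) : Set (Fin k → ℝ) :=
  {x | ∃ y : BoxIdx k (2 * D + 2) → ℝ,
      (momentMatrix D (2 * D + 2) y).PosSemidef ∧ (locMatrix D (2 * D + 2) q y).PosSemidef ∧
      0 ≤ rieszFun (2 * D + 2) y p ∧ boxMoment (2 * D + 2) y 0 = 1 ∧
      ∀ i, boxMoment (2 * D + 2) y (Finsupp.single i 1) = x i}

/-- **The moment relaxation is a spectrahedral shadow** (it is the projection to the degree-one
moments of a set cut out by two LMIs, one scalar inequality and affine equations).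
[cite: HeltonNie2008, §2.2 (SDP representation II)] -/
theorem isSpectrahedralShadow_momentRelaxation (D : ℕ) (p q : MvPolynomial (Fin k) ℝ) :
    IsSpectrahedralShadow (momentRelaxation D p q) := by
  classical
  let T := 2 * D + 2
  let V := BoxIdx k T → ℝ
  let A : ((Fin k → ℝ) × V) →ₗ[ℝ] Matrix (BoxIdx k D ⊕ BoxIdx k D) (BoxIdx k D ⊕ BoxIdx k D) ℝ :=
    blockDiagLin (momentMatrixLin D T ∘ₗ LinearMap.snd ℝ _ _)
      (locMatrixLin D T q ∘ₗ LinearMap.snd ℝ _ _)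
  let L : ((Fin k → ℝ) × V) →ₗ[ℝ] (Fin 1 → ℝ) :=
    LinearMap.pi fun _ => rieszLin T p ∘ₗ LinearMap.snd ℝ _ _
  let E : ((Fin k → ℝ) × V) →ₗ[ℝ] (Option (Fin k) → ℝ) :=
    LinearMap.pi fun o => Option.elim o (boxMomentLin T 0 ∘ₗ LinearMap.snd ℝ _ _)
      (fun i => boxMomentLin T (Finsupp.single i 1) ∘ₗ LinearMap.snd ℝ _ _ -
        (LinearMap.proj i : (Fin k → ℝ) →ₗ[ℝ] ℝ) ∘ₗ LinearMap.fst ℝ _ _)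
  let γ : Option (Fin k) → ℝ := fun o => Option.elim o 1 (fun _ => 0)
  refine isSpectrahedralShadow_of_rep_constraints A 0 L 0 E γ fun x => ?_
  simp only [momentRelaxation, Set.mem_setOf_eq]
  refine exists_congr fun y => ?_
  have hE : E (x, y) = γ ↔ boxMoment T y 0 = 1 ∧ ∀ i, boxMoment T y (Finsupp.single i 1) = x i := by
    simp only [E, γ, funext_iff, Option.forall, LinearMap.pi_apply, Option.elim_none, Option.elim_some,
      LinearMap.comp_apply, LinearMap.snd_apply, LinearMap.fst_apply, boxMomentLin_apply,
      LinearMap.sub_apply, LinearMap.proj_apply, sub_eq_zero]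
  rw [hE]
  simp only [A, L, blockDiagLin_apply, LinearMap.comp_apply, LinearMap.snd_apply,
    momentMatrixLin_apply, locMatrixLin_apply, add_zero, posSemidef_fromBlocks_zero_iff,
    LinearMap.pi_apply, rieszLin_apply, Pi.zero_apply, forall_const]
  tauto

/-- `degᵢ (f²) ≤ 2D` for a box polynomial of order `D`. [folklore] -/
theorem degreeOf_boxPoly_sq_le {D : ℕ} (c : BoxIdx k D → ℝ) (i : Fin k) :
    degreeOf i (boxPoly D c ^ 2) ≤ 2 * D := by
  rw [sq]
  refine (degreeOf_mul_le i _ _).trans ?_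
  have := degreeOf_boxPoly_le c i
  omega

/-- **`N ⊆ R_D`**: the Dirac moments of a point of `{p ≥ 0, q ≥ 0}` are feasible
(when `degᵢ p ≤ 2D+2` and `degᵢ q ≤ 2`). [cite: HeltonNie2008, §2.1 (`S ⊆ ρ_N(Ŝ_N)`)] -/
theorem subset_momentRelaxation {D : ℕ} {p q : MvPolynomial (Fin k) ℝ}
    (hp : ∀ i, degreeOf i p ≤ 2 * D + 2) (hq : ∀ i, degreeOf i q ≤ 2) :
    {x | 0 ≤ MvPolynomial.eval x p ∧ 0 ≤ MvPolynomial.eval x q} ⊆ momentRelaxation D p q := by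
  rintro x ⟨hpx, hqx⟩
  have hsq : ∀ c : BoxIdx k D → ℝ, ∀ i, degreeOf i (boxPoly D c ^ 2) ≤ 2 * D + 2 := fun c i =>
    (degreeOf_boxPoly_sq_le c i).trans (by omega)
  have hqsq : ∀ c : BoxIdx k D → ℝ, ∀ i, degreeOf i (q * boxPoly D c ^ 2) ≤ 2 * D + 2 := fun c i =>
    (degreeOf_mul_le i _ _).trans (by have := hq i; have := degreeOf_boxPoly_sq_le c i; omega)
  refine ⟨pointMoments (2 * D + 2) x, ?_, ?_, ?_, ?_, ?_⟩
  · refine Matrix.PosSemidef.of_dotProduct_mulVec_nonneg (momentMatrix_isHermitian _) fun c => ?_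
    rw [star_trivial, ← rieszFun_boxPoly_sq, rieszFun_pointMoments x (hsq c), map_pow]
    exact sq_nonneg _
  · refine Matrix.PosSemidef.of_dotProduct_mulVec_nonneg (locMatrix_isHermitian _ _) fun c => ?_
    rw [star_trivial, ← rieszFun_mul_boxPoly_sq, rieszFun_pointMoments x (hqsq c), map_mul, map_pow]
    exact mul_nonneg hqx (sq_nonneg _)
  · rwa [rieszFun_pointMoments x hp]
  · rw [boxMoment_pointMoments x fun i => Nat.zero_le _]; simp
  · intro i
    rw [boxMoment_pointMoments x fun j => by
      rw [Finsupp.single_apply]; split_ifs <;> omega]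
    simp only [Finsupp.single_apply, pow_ite, pow_one, pow_zero]
    rw [Finset.prod_ite_eq]; simp

/-- **The functional of a feasible point**: `x ∈ R_D` carries a linear functional `L` on `ℝ[X]`
with `L(1) = 1`, `L(Xᵢ) = xᵢ`, `L(h²) ≥ 0` and `L(q h²) ≥ 0` for all `h` of total degree `≤ D`,
and `L(p) ≥ 0`. [cite: HeltonNie2008, §2.1 (linear functionals separating points)] -/
theorem exists_functional_of_mem_momentRelaxation {D : ℕ} {p q : MvPolynomial (Fin k) ℝ}
    {x : Fin k → ℝ} (hx : x ∈ momentRelaxation D p q) :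
    ∃ L : MvPolynomial (Fin k) ℝ →ₗ[ℝ] ℝ, L 1 = 1 ∧ (∀ i, L (X i) = x i) ∧
      (∀ h : MvPolynomial (Fin k) ℝ, h.totalDegree ≤ D → 0 ≤ L (h ^ 2)) ∧
      (∀ h : MvPolynomial (Fin k) ℝ, h.totalDegree ≤ D → 0 ≤ L (q * h ^ 2)) ∧ 0 ≤ L p := by
  obtain ⟨y, hM, hMq, hp, h0, h1⟩ := hx
  refine ⟨rieszFun _ y, by rw [rieszFun_one, h0], fun i => by rw [rieszFun_X, h1],
    fun h hh => ?_, fun h hh => ?_, hp⟩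
  · obtain ⟨c, rfl⟩ := exists_boxPoly_eq h hh
    rw [rieszFun_boxPoly_sq]
    have := hM.dotProduct_mulVec_nonneg c
    rwa [star_trivial] at this
  · obtain ⟨c, rfl⟩ := exists_boxPoly_eq h hh
    rw [rieszFun_mul_boxPoly_sq]
    have := hMq.dotProduct_mulVec_nonneg c
    rwa [star_trivial] at this

/-- A linear functional on `ℝᵏ` in coordinates. [folklore] -/
theorem linearMap_apply_eq_sum_single (c : (Fin k → ℝ) →ₗ[ℝ] ℝ) (v : Fin k → ℝ) :
    c v = ∑ i, v i * c (Pi.single i 1) := by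
  rw [LinearMap.pi_apply_eq_sum_univ c v]
  refine Finset.sum_congr rfl fun i _ => ?_
  rw [smul_eq_mul]
  congr 2
  funext j
  rcases eq_or_ne i j with rfl | hij
  · simp
  · rw [Pi.single_apply, if_neg (Ne.symm hij), if_neg hij]

/-- **Exactness criterion** (Helton–Nie's separation argument; Lasserre's "PP-BDNR ⇒ exact").
Let `N = {p ≥ 0, q ≥ 0}` be compact, convex and non-empty, and suppose that for every linear `c`
and every minimiser `w ∈ N` of `c` on `N` there is `λ ≥ 0` such that the affine polynomial
`ℓ - λ p`, `ℓ = Σᵢ c(eᵢ)(Xᵢ - wᵢ)`, is non-negative under every linear functional on `ℝ[X]` that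
is non-negative on squares of degree `≤ D` and on `q`-multiples of such squares. Then
`R_D ⊆ N`. [cite: HeltonNie2008, §2.2 (PP-BDNR implies exactness of the lifted LMI)] -/
theorem momentRelaxation_subset_of_certificates {D : ℕ} {p q : MvPolynomial (Fin k) ℝ}
    {N : Set (Fin k → ℝ)} (hN : ∀ x, x ∈ N ↔ 0 ≤ MvPolynomial.eval x p ∧ 0 ≤ MvPolynomial.eval x q)
    (hcpt : IsCompact N) (hconv : Convex ℝ N) (hne : N.Nonempty)
    (hcert : ∀ (c : (Fin k → ℝ) →ₗ[ℝ] ℝ) (w : Fin k → ℝ), w ∈ N → (∀ z ∈ N, c w ≤ c z) →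
      ∃ lam : ℝ, 0 ≤ lam ∧ ∀ L : MvPolynomial (Fin k) ℝ →ₗ[ℝ] ℝ,
        (∀ h : MvPolynomial (Fin k) ℝ, h.totalDegree ≤ D → 0 ≤ L (h ^ 2)) →
        (∀ h : MvPolynomial (Fin k) ℝ, h.totalDegree ≤ D → 0 ≤ L (q * h ^ 2)) →
        0 ≤ L (∑ i, C (c (Pi.single i 1)) * (X i - C (w i)) - C lam * p)) :
    momentRelaxation D p q ⊆ N := by
  intro x hx
  by_contra hxN
  have _ := hN
  obtain ⟨L, hL1, hLX, hLsq, hLq, hLp⟩ := exists_functional_of_mem_momentRelaxation hx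
  obtain ⟨f, u, hfx, hfN⟩ := geometric_hahn_banach_point_closed hconv hcpt.isClosed hxN
  obtain ⟨w, hw, hmin⟩ := hcpt.exists_isMinOn hne f.continuous.continuousOn
  obtain ⟨lam, hlam, hc⟩ := hcert f.toLinearMap w hw fun z hz => hmin hz
  have h := hc L hLsq hLq
  have hLℓ : L (∑ i, C ((f.toLinearMap) (Pi.single i 1)) * (X i - C (w i))) = f x - f w := by
    rw [map_sum]
    have hterm : ∀ i, L (C ((f.toLinearMap) (Pi.single i 1)) * (X i - C (w i))) =
        (x i - w i) * f (Pi.single i 1) := by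
      intro i
      rw [C_mul', map_smul, map_sub, hLX, show (C (w i) : MvPolynomial (Fin k) ℝ) = w i • 1 by
        rw [C_eq_smul_one], map_smul, hL1, smul_eq_mul, smul_eq_mul, mul_one,
        ContinuousLinearMap.coe_coe]
      ring
    simp only [hterm]
    rw [show f x - f w = f.toLinearMap (x - w) by simp, linearMap_apply_eq_sum_single]
    simp
  have hp' : L (C lam * p) = lam * L p := by rw [C_mul', map_smul, smul_eq_mul]
  rw [map_sub, hLℓ, hp'] at h
  have h1 := hfN w hw
  have h2 := mul_nonneg hlam hLp
  linarith

/-- **`N = R_D` is a spectrahedral shadow** under the exactness criterion.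
[cite: HeltonNie2008, §2.2 (SDP representation II)] -/
theorem isSpectrahedralShadow_of_certificates {D : ℕ} {p q : MvPolynomial (Fin k) ℝ}
    {N : Set (Fin k → ℝ)} (hN : ∀ x, x ∈ N ↔ 0 ≤ MvPolynomial.eval x p ∧ 0 ≤ MvPolynomial.eval x q)
    (hp : ∀ i, degreeOf i p ≤ 2 * D + 2) (hq : ∀ i, degreeOf i q ≤ 2)
    (hcpt : IsCompact N) (hconv : Convex ℝ N) (hne : N.Nonempty)
    (hcert : ∀ (c : (Fin k → ℝ) →ₗ[ℝ] ℝ) (w : Fin k → ℝ), w ∈ N → (∀ z ∈ N, c w ≤ c z) →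
      ∃ lam : ℝ, 0 ≤ lam ∧ ∀ L : MvPolynomial (Fin k) ℝ →ₗ[ℝ] ℝ,
        (∀ h : MvPolynomial (Fin k) ℝ, h.totalDegree ≤ D → 0 ≤ L (h ^ 2)) →
        (∀ h : MvPolynomial (Fin k) ℝ, h.totalDegree ≤ D → 0 ≤ L (q * h ^ 2)) →
        0 ≤ L (∑ i, C (c (Pi.single i 1)) * (X i - C (w i)) - C lam * p)) :
    IsSpectrahedralShadow N := by
  have h1 : N ⊆ momentRelaxation D p q := fun x hx => subset_momentRelaxation hp hq ((hN x).1 hx)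
  have h2 : momentRelaxation D p q ⊆ N :=
    momentRelaxation_subset_of_certificates hN hcpt hconv hne hcert
  rw [Set.Subset.antisymm h1 h2]
  exact isSpectrahedralShadow_momentRelaxation D p q

end Literature.AlgebraicGeometry.HyperbolicPolynomials
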